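import Mathlib
import Summits.MatrixMultiplication.MatrixMultiplication.Theses.CondensationDistance

/-!
# `CondensationDistance.CondensationSound` (stmt-MatrixMultiplication-15939) — Negative lane, I:
# the hypothesis "the target is listed" is load-bearing

Crux (route `CondensationDistance`, rank 5, soundness bridge): every valid octahedral Plücker
derivation `f : Fin l → Finset (Fin (n + m'))` that LISTS the target `[n, 2n)` yields
`Derivable ℂ (5 * l) (entries of Z) {det X}`.

`condensationSound_false_without_target`: the crux with the hypothesis `∃ i, f i = [n, 2n)` deleted
(everything else verbatim) is FALSE — at `n = m' = 2`, `l = 0` the empty derivation is valid and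
the conclusion `Derivable ℂ 0 (entries) {det X₂}` says that `det X₂` is an entry of `Z` or a
constant of `ℂ(Z)`, which it is not (`det_two_not_entry_or_const`: evaluate at the all-ones point,
where `det X₂ = 0` and every entry is `1`, and at the identity point, where `det X₂ = 1`).
So any proof of the crux must locate the target inside the derivation (the budget `5 * l` is not
an absolute cost bound for `det X`).  Crux disprover, cycle 1
(`Cruxes/CondensationSound/Disproof.lean` §(a1)); the crux itself is true as typed.
-/

set_option linter.dupNamespace false

namespace Summit.MatrixMultiplication.MatrixMultiplication.Theorems

namespace CondensationSoundNeg

open MvPolynomial Literature.Computability.AlgebraicComplexity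

/-- `det X₂` (the leading `2 × 2` minor of the generic `2 × m'` matrix `Z`, `m' ≥ 2`) is neither an
entry of `Z` nor a constant, as an element of `ℂ(Z)`: `ℂ[Z] → ℂ(Z)` is injective, and evaluating at
the all-ones point gives `det = 0 ≠ 1 = entry`, at the identity point `det = 1`, while a constant has
the same value at both points. [folklore] -/
theorem det_two_not_entry_or_const (m' : ℕ) (h : 2 ≤ m') :
    algebraMap (MvPolynomial (Fin 2 × Fin m') ℂ) (FractionRing (MvPolynomial (Fin 2 × Fin m') ℂ))
        (Matrix.det (Matrix.of fun i j : Fin 2 => MvPolynomial.X (i, Fin.castLE h j))) ∉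
      (Set.range fun p : Fin 2 × Fin m' =>
          algebraMap (MvPolynomial (Fin 2 × Fin m') ℂ) (FractionRing (MvPolynomial (Fin 2 × Fin m') ℂ))
            (MvPolynomial.X p)) ∪
        Set.range (algebraMap ℂ (FractionRing (MvPolynomial (Fin 2 × Fin m') ℂ))) := by
  have hinj := IsFractionRing.injective (MvPolynomial (Fin 2 × Fin m') ℂ)
    (FractionRing (MvPolynomial (Fin 2 × Fin m') ℂ))
  rintro (⟨p, hp⟩ | ⟨c, hc⟩)
  · have e := hinj hp
    have h1 := congrArg (MvPolynomial.eval fun _ : Fin 2 × Fin m' => (1 : ℂ)) e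
    rw [RingHom.map_det] at h1
    simp [Matrix.det_fin_two] at h1
  · rw [IsScalarTower.algebraMap_apply ℂ (MvPolynomial (Fin 2 × Fin m') ℂ)
      (FractionRing (MvPolynomial (Fin 2 × Fin m') ℂ)), MvPolynomial.algebraMap_eq] at hc
    have e := hinj hc
    have h1 := congrArg (MvPolynomial.eval fun _ : Fin 2 × Fin m' => (1 : ℂ)) e
    have h2 := congrArg
      (MvPolynomial.eval fun ij : Fin 2 × Fin m' => if ij.1.val = ij.2.val then (1 : ℂ) else 0) e
    rw [RingHom.map_det] at h1 h2
    simp [Matrix.det_fin_two] at h1 h2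
    rw [h1] at h2
    exact zero_ne_one h2

/-- **"The target is listed" is load-bearing for `CondensationSound`.**  The crux with the
hypothesis `∃ i : Fin l, f i = {x | n ≤ x < 2n}` deleted — validity clause, input set, conclusion
and budget verbatim — is false: witness `n = m' = 2`, `l = 0`, the empty (vacuously valid)
derivation; `Derivable ℂ 0 A {det X₂}` forces `det X₂ ∈ A ∪ consts`, contradicting
`det_two_not_entry_or_const`. [folklore] -/
theorem condensationSound_false_without_target :
    ¬ ∀ (n m' : ℕ) (h : n ≤ m') (l : ℕ) (f : Fin l → Finset (Fin (n + m'))),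
      (∀ i : Fin l, ∃ p ∈ f i, ∃ q ∈ f i, p ≠ q ∧ ∃ u ∉ f i, ∃ v ∉ f i, u ≠ v ∧
        ∀ J ∈ [insert u ((f i).erase p), insert v ((f i).erase p), insert u ((f i).erase q),
          insert v ((f i).erase q), insert u (insert v (((f i).erase p).erase q))],
          (J.card = n ∧ (J.filter fun x : Fin (n + m') => n ≤ x.val).card ≤ 1) ∨
            ∃ j : Fin l, j < i ∧ f j = J) →
      Literature.Computability.AlgebraicComplexity.Derivable ℂ (5 * l)
        (Set.range fun p : Fin n × Fin m' =>
          algebraMap (MvPolynomial (Fin n × Fin m') ℂ) (FractionRing (MvPolynomial (Fin n × Fin m') ℂ))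
            (MvPolynomial.X p))
        {algebraMap (MvPolynomial (Fin n × Fin m') ℂ) (FractionRing (MvPolynomial (Fin n × Fin m') ℂ))
          (Matrix.det (Matrix.of fun i j : Fin n => MvPolynomial.X (i, Fin.castLE h j)))} := by
  intro H
  obtain ⟨l, -, hlen, hsub⟩ := H 2 2 le_rfl 0 (fun i => i.elim0) (fun i => i.elim0)
  obtain rfl : l = [] := List.eq_nil_of_length_eq_zero (Nat.le_zero.mp hlen)
  have hmem := hsub (Set.mem_singleton _)
  simp only [List.not_mem_nil, Set.setOf_false, Set.union_empty] at hmem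
  exact det_two_not_entry_or_const 2 le_rfl hmem

end CondensationSoundNeg

end Summit.MatrixMultiplication.MatrixMultiplication.Theorems
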